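import Mathlib
import Literature.Analysis.UnboundedOperators.ConjugateOperatorRegularity
import HarnessLib
import Summits.AtomisticToContinuum.FouriersLaw.Theorems.EmbeddedDrudeMourreMourreDissolutionLAPRegularityAlgebra

/-!
# Stub `stub_mourreThresholdLAP` — Mourre LAP infrastructure 8: regularity algebra II (products, inverses)

Item `stmt-AtomisticToContinuum-12594` (crux `MourreDissolution` of route `EmbeddedDrudeMourre`,
sub-problem `FouriersLaw`), line `separable-vertex-faddeev-pair-sector`, stub S6
`stub_mourreThresholdLAP` (Mourre's limiting absorption principle; NOT in the tree). Step L2 of the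
proof map, pure `C¹(A; H)` / `𝒞^{1,1}(A; H)` algebra over the tree's `ConjugateOperatorRegularity`
(ABG = Amrein–Boutet de Monvel–Georgescu 1996, §5.1–5.2). Over `…LAPRegularityAlgebra`:

* `𝒞^{1,1}(A; H) ∩ C¹(A; H)` is an algebra stable under inverses (ABG Prop. 5.2.3–5.2.4 /
  Thm 5.2.6 for `(s, p) = (1, 1)`; headline `isOfClassC11_inverse_rule`): the discrete Leibniz
  rule `[𝒲 - 1]²(ST) = ([𝒲 - 1]²S) 𝒲²T + 2(𝒲S - S)(𝒲²T - 𝒲T) + S [𝒲 - 1]²T` and the inverse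
  rule `[𝒲 - 1]²(S⁻¹) = -𝒲²S⁻¹ ([𝒲 - 1]²S) 𝒲S⁻¹ - (𝒲²S⁻¹ - 𝒲S⁻¹)(𝒲S - S)𝒲S⁻¹
  - 𝒲S⁻¹(𝒲S - S)(𝒲S⁻¹ - S⁻¹)`, with the cross terms controlled by the Lipschitz bound (this is
  where `C¹` enters: the inclusion `𝒞^{1,1} ⊂ C¹`, ABG (5.2.19), is not in the tree and both
  classes are assumed, exactly as in the stub's hypotheses `HamiltonianOfClassC1 ∧ C11`).
-/


noncomputable section

open MeasureTheory Complex Filter Topology Set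
open scoped InnerProductSpace ComplexConjugate ENNReal NNReal

namespace Summit.AtomisticToContinuum.FouriersLaw.Theorems.MourreDissolution

open Literature.Analysis.UnboundedOperators
open Literature.Analysis.UnboundedOperators.UnitaryRep

variable {H : Type*} [NormedAddCommGroup H] [InnerProductSpace ℂ H] [CompleteSpace H]

/-! ## §1. Products and inverses in `𝒞^{1,1}(A; H) ∩ C¹(A; H)` -/

/-- **Discrete Leibniz rule for the second difference**:
`[𝒲(x) - 1]²(ST) = ([𝒲(x) - 1]²S) 𝒲(2x)T + 2 (𝒲(x)S - S)(𝒲(2x)T - 𝒲(x)T) + S [𝒲(x) - 1]²T`.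
[cite: AmreinBoutetdeMonvelGeorgescu1996, §5.2 (proof of Prop. 5.2.3)] -/
theorem secondDifference_mul (A : OneParameterUnitaryGroup H) (x : ℝ) (S T : H →L[ℂ] H) :
    A.secondDifference x (S * T) =
      A.secondDifference x S * A.conjAut (2 * x) T +
        2 • ((A.conjAut x S - S) * (A.conjAut (2 * x) T - A.conjAut x T)) +
        S * A.secondDifference x T := by
  simp only [secondDifference, conjAut_mul, two_smul]
  noncomm_ring

/-- `𝒲(2x)T - 𝒲(x)T = 𝒲(x)[𝒲(x)T - T]`, so it has the norm of `𝒲(x)T - T`. [folklore] -/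
theorem norm_conjAut_two_mul_sub (A : OneParameterUnitaryGroup H) (x : ℝ) (T : H →L[ℂ] H) :
    ‖A.conjAut (2 * x) T - A.conjAut x T‖ = ‖A.conjAut x T - T‖ := by
  rw [two_mul, conjAut_add, ← conjAut_sub_op, norm_conjAut]

/-- Norm form of the Leibniz rule:
`‖[𝒲(x)-1]²(ST)‖ ≤ ‖[𝒲(x)-1]²S‖ ‖T‖ + 2 ‖𝒲(x)S - S‖ ‖𝒲(x)T - T‖ + ‖S‖ ‖[𝒲(x)-1]²T‖`. [folklore] -/
theorem norm_secondDifference_mul_le (A : OneParameterUnitaryGroup H) (x : ℝ) (S T : H →L[ℂ] H) :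
    ‖A.secondDifference x (S * T)‖ ≤ ‖A.secondDifference x S‖ * ‖T‖ +
      2 * (‖A.conjAut x S - S‖ * ‖A.conjAut x T - T‖) + ‖S‖ * ‖A.secondDifference x T‖ := by
  rw [secondDifference_mul]
  refine (norm_add₃_le).trans ?_
  gcongr
  · exact (norm_mul_le _ _).trans (by rw [norm_conjAut])
  · rw [← norm_conjAut_two_mul_sub A x T]
    refine norm_nsmul_le.trans ?_
    simp only [Nat.cast_ofNat]
    gcongr
    exact norm_mul_le _ _
  · exact norm_mul_le _ _

/-- **`𝒞^{1,1}(A; H) ∩ C¹(A; H)` is closed under products** (ABG Prop. 5.2.3 (b) with (5.2.10) for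
`(s, p) = (1, 1)`; the cross term `2‖𝒲S - S‖ ‖𝒲T - T‖ ≤ 2x² ‖[S,iA]‖ ‖[T,iA]‖` is where `C¹`
enters). [cite: AmreinBoutetdeMonvelGeorgescu1996, Prop. 5.2.3] -/
theorem isOfClassC11_mul {A : OneParameterUnitaryGroup H} {S T : H →L[ℂ] H}
    (hS1 : A.IsOfClassC1 S) (hT1 : A.IsOfClassC1 T) (hS : A.IsOfClassC11 S)
    (hT : A.IsOfClassC11 T) : A.IsOfClassC11 (S * T) := by
  obtain ⟨DS, hDS⟩ := hS1
  obtain ⟨DT, hDT⟩ := hT1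
  refine isOfClassC11_of_le₂ hS hT (norm_nonneg T) (norm_nonneg S) (b := 2 * (‖DS‖ * ‖DT‖))
    (by positivity) fun x _ => ?_
  by_cases hx0 : x = 0
  · subst hx0
    simp only [secondDifference_zero, norm_zero, zero_div, mul_zero, zero_add]
    positivity
  have hx2 : 0 < x ^ 2 := by positivity
  have hcross : ‖A.conjAut x S - S‖ * ‖A.conjAut x T - T‖ ≤ x ^ 2 * (‖DS‖ * ‖DT‖) := by
    calc ‖A.conjAut x S - S‖ * ‖A.conjAut x T - T‖ ≤ (|x| * ‖DS‖) * (|x| * ‖DT‖) :=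
          mul_le_mul (norm_conjAut_sub_le hDS x) (norm_conjAut_sub_le hDT x) (norm_nonneg _)
            (by positivity)
      _ = x ^ 2 * (‖DS‖ * ‖DT‖) := by rw [← sq_abs x]; ring
  have hmain : ‖A.secondDifference x (S * T)‖ ≤ ‖A.secondDifference x S‖ * ‖T‖ +
      2 * (x ^ 2 * (‖DS‖ * ‖DT‖)) + ‖S‖ * ‖A.secondDifference x T‖ :=
    (norm_secondDifference_mul_le A x S T).trans (by gcongr)
  rw [div_le_iff₀ hx2]
  refine hmain.trans (le_of_eq ?_)
  field_simp
  ring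

/-- **Second difference of an inverse** (`T = S⁻¹`, `Sᵢ = 𝒲(ix)S`, `Tᵢ = 𝒲(ix)T = Sᵢ⁻¹`):
`[𝒲(x) - 1]²T = -T₂ ([𝒲(x) - 1]²S) T₁ - (T₂ - T₁)(S₁ - S)T₁ - T₁(S₁ - S)(T₁ - T)`.
[cite: AmreinBoutetdeMonvelGeorgescu1996, Prop. 5.2.4] -/
theorem secondDifference_inverse (A : OneParameterUnitaryGroup H) (x : ℝ) {S T : H →L[ℂ] H}
    (hST : S * T = 1) (hTS : T * S = 1) :
    A.secondDifference x T =
      -(A.conjAut (2 * x) T * A.secondDifference x S * A.conjAut x T) -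
        (A.conjAut (2 * x) T - A.conjAut x T) * (A.conjAut x S - S) * A.conjAut x T -
        A.conjAut x T * (A.conjAut x S - S) * (A.conjAut x T - T) := by
  have h11 : A.conjAut x S * A.conjAut x T = 1 := conjAut_mul_conjAut_eq_one A hST x
  have h11' : A.conjAut x T * A.conjAut x S = 1 := conjAut_mul_conjAut_eq_one A hTS x
  have h22' : A.conjAut (2 * x) T * A.conjAut (2 * x) S = 1 := conjAut_mul_conjAut_eq_one A hTS _
  have expand : -(A.conjAut (2 * x) T * A.secondDifference x S * A.conjAut x T) -
        (A.conjAut (2 * x) T - A.conjAut x T) * (A.conjAut x S - S) * A.conjAut x T -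
        A.conjAut x T * (A.conjAut x S - S) * (A.conjAut x T - T) =
      -(A.conjAut (2 * x) T * A.conjAut (2 * x) S) * A.conjAut x T +
        A.conjAut (2 * x) T * (A.conjAut x S * A.conjAut x T) +
        (A.conjAut x T * A.conjAut x S) * T - A.conjAut x T * (S * T) := by
    simp only [secondDifference, two_smul]
    noncomm_ring
  rw [expand, h22', h11, h11', hST]
  simp only [secondDifference, two_smul]
  noncomm_ring

/-- Norm form: `‖[𝒲(x)-1]²(S⁻¹)‖ ≤ ‖S⁻¹‖² ‖[𝒲(x)-1]²S‖ + 2 ‖S⁻¹‖ ‖𝒲(x)S - S‖ ‖𝒲(x)S⁻¹ - S⁻¹‖`.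
[folklore] -/
theorem norm_secondDifference_inverse_le (A : OneParameterUnitaryGroup H) (x : ℝ)
    {S T : H →L[ℂ] H} (hST : S * T = 1) (hTS : T * S = 1) :
    ‖A.secondDifference x T‖ ≤ ‖T‖ ^ 2 * ‖A.secondDifference x S‖ +
      2 * (‖T‖ * (‖A.conjAut x S - S‖ * ‖A.conjAut x T - T‖)) := by
  rw [secondDifference_inverse A x hST hTS]
  have e21 := norm_conjAut_two_mul_sub A x T
  calc ‖-(A.conjAut (2 * x) T * A.secondDifference x S * A.conjAut x T) -
        (A.conjAut (2 * x) T - A.conjAut x T) * (A.conjAut x S - S) * A.conjAut x T -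
        A.conjAut x T * (A.conjAut x S - S) * (A.conjAut x T - T)‖
      ≤ ‖A.conjAut (2 * x) T * A.secondDifference x S * A.conjAut x T‖ +
        ‖(A.conjAut (2 * x) T - A.conjAut x T) * (A.conjAut x S - S) * A.conjAut x T‖ +
        ‖A.conjAut x T * (A.conjAut x S - S) * (A.conjAut x T - T)‖ := by
        refine (norm_sub_le _ _).trans ?_
        gcongr
        exact (norm_sub_le _ _).trans (by rw [norm_neg])
    _ ≤ ‖T‖ * ‖A.secondDifference x S‖ * ‖T‖ +
        ‖A.conjAut x T - T‖ * ‖A.conjAut x S - S‖ * ‖T‖ +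
        ‖T‖ * ‖A.conjAut x S - S‖ * ‖A.conjAut x T - T‖ := by
        gcongr
        · exact (norm_mul₃_le).trans (by rw [norm_conjAut, norm_conjAut])
        · exact (norm_mul₃_le).trans (by rw [e21, norm_conjAut])
        · exact (norm_mul₃_le).trans (by rw [norm_conjAut])
    _ = ‖T‖ ^ 2 * ‖A.secondDifference x S‖ +
        2 * (‖T‖ * (‖A.conjAut x S - S‖ * ‖A.conjAut x T - T‖)) := by ring

/-- **`𝒞^{1,1}(A; H) ∩ C¹(A; H)` is closed under inverses** (ABG Prop. 5.2.4 for `(s, p) = (1, 1)`):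
if `S ∈ C¹ ∩ 𝒞^{1,1}` has the two-sided bounded inverse `T`, then `T ∈ 𝒞^{1,1}(A; H)`
(and `T ∈ C¹(A; H)` by `isOfClassC1_inverse`). [cite: AmreinBoutetdeMonvelGeorgescu1996, Prop. 5.2.4] -/
theorem isOfClassC11_inverse {A : OneParameterUnitaryGroup H} {S T : H →L[ℂ] H}
    (hS1 : A.IsOfClassC1 S) (hS : A.IsOfClassC11 S) (hST : S * T = 1) (hTS : T * S = 1) :
    A.IsOfClassC11 T := by
  obtain ⟨DS, hDS⟩ := hS1
  have hDT := hasCommutator_inverse hDS hST hTS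
  refine isOfClassC11_of_le hS (a := ‖T‖ ^ 2) (b := 2 * (‖T‖ * (‖DS‖ * ‖-(T * DS * T)‖)))
    (by positivity) (by positivity) fun x _ => ?_
  by_cases hx0 : x = 0
  · subst hx0
    simp only [secondDifference_zero, norm_zero, zero_div, mul_zero, zero_add]
    positivity
  have hx2 : 0 < x ^ 2 := by positivity
  have hcross : ‖A.conjAut x S - S‖ * ‖A.conjAut x T - T‖ ≤
      x ^ 2 * (‖DS‖ * ‖-(T * DS * T)‖) := by
    calc ‖A.conjAut x S - S‖ * ‖A.conjAut x T - T‖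
        ≤ (|x| * ‖DS‖) * (|x| * ‖-(T * DS * T)‖) :=
          mul_le_mul (norm_conjAut_sub_le hDS x) (norm_conjAut_sub_le hDT x) (norm_nonneg _)
            (by positivity)
      _ = x ^ 2 * (‖DS‖ * ‖-(T * DS * T)‖) := by rw [← sq_abs x]; ring
  have hmain : ‖A.secondDifference x T‖ ≤ ‖T‖ ^ 2 * ‖A.secondDifference x S‖ +
      2 * (‖T‖ * (x ^ 2 * (‖DS‖ * ‖-(T * DS * T)‖))) :=
    (norm_secondDifference_inverse_le A x hST hTS).trans (by gcongr)
  rw [div_le_iff₀ hx2]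
  refine hmain.trans (le_of_eq ?_)
  field_simp

/-- `C¹ ∩ 𝒞^{1,1}` is closed under inverses (both classes at once). [folklore] -/
theorem isOfClassC1_and_C11_inverse {A : OneParameterUnitaryGroup H} {S T : H →L[ℂ] H}
    (hS1 : A.IsOfClassC1 S) (hS : A.IsOfClassC11 S) (hST : S * T = 1) (hTS : T * S = 1) :
    A.IsOfClassC1 T ∧ A.IsOfClassC11 T :=
  ⟨isOfClassC1_inverse hS1 hST hTS, isOfClassC11_inverse hS1 hS hST hTS⟩

/-- `C¹ ∩ 𝒞^{1,1}` is closed under products (both classes at once). [folklore] -/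
theorem isOfClassC1_and_C11_mul {A : OneParameterUnitaryGroup H} {S T : H →L[ℂ] H}
    (hS1 : A.IsOfClassC1 S) (hS : A.IsOfClassC11 S) (hT1 : A.IsOfClassC1 T)
    (hT : A.IsOfClassC11 T) : A.IsOfClassC1 (S * T) ∧ A.IsOfClassC11 (S * T) :=
  ⟨hS1.mul hT1, isOfClassC11_mul hS1 hT1 hS hT⟩

/-! ## §2. Headline (registered helper stub) -/

/-- **Inverse rule in `C¹ ∩ 𝒞^{1,1}`, headline form** (all binders explicit; registered helper stub
of `stub_mourreThresholdLAP`): a two-sided bounded inverse of `S ∈ C¹(A; H) ∩ 𝒞^{1,1}(A; H)` is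
in `C¹(A; H) ∩ 𝒞^{1,1}(A; H)`. [cite: AmreinBoutetdeMonvelGeorgescu1996, Prop. 5.2.4] -/
theorem isOfClassC11_inverse_rule :
    ∀ (K : Type) [NormedAddCommGroup K] [InnerProductSpace ℂ K] [CompleteSpace K]
      (A : Literature.Analysis.UnboundedOperators.OneParameterUnitaryGroup K) (S T : K →L[ℂ] K),
      A.IsOfClassC1 S → A.IsOfClassC11 S → S * T = 1 → T * S = 1 →
        A.IsOfClassC1 T ∧ A.IsOfClassC11 T := by
  intro K _ _ _ A S T h1 h11 hST hTS
  exact isOfClassC1_and_C11_inverse h1 h11 hST hTS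

end Summit.AtomisticToContinuum.FouriersLaw.Theorems.MourreDissolution
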